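/-
Copyright (c) 2026. Released under Apache 2.0 license.
-/
import Literature.NumberTheory.Automorphic.UnboundedDenominatorsInvariantHomRealization
import Literature.NumberTheory.EllipticCurves.ModularCurveGamma0IndexProofs
import HarnessLib

/-!
# The invariant form of CDT Cor. 4.5.3 via cyclic subgroups of `SL₂(ℤ/N)`

Transfer reduction (`UnboundedDenominatorsInvariantHomRealization`) with `H` the preimage in `SL₂(ℤ)` of a
CYCLIC subgroup `⟨c̄⟩ ≤ SL₂(ℤ/N)`: then `H = ⟨c⟩·Γ(N)` for any lift `c`, its image in the central extension
`SL₂(ℤ)/K_θ` is a central extension of a cyclic group, hence abelian, so `[H, H] ≤ K_θ` and the local condition is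
automatic.  Hence:

* `map_eq_one_of_mem_Gamma_mul_of_zpowers` / `cor453_invariant_form_of_zpowers` — **if `SL₂(ℤ/N)` contains an
  element `c̄` with `|Q|` prime to `[SL₂(ℤ/N) : ⟨c̄⟩]`, every `SL₂(ℤ)`-invariant `θ : Γ(N) → Q` kills `Γ(12N)`.**

With `c̄ = T̄` (index `[SL₂(ℤ):Γ₁(N)]`) this is `UnboundedDenominatorsInvariantHomGamma1`; with the split torus
`c̄ = diag(g, g⁻¹)` at prime level `N = p` (order `p - 1`, index `p(p+1)`) it gives the targets of order prime to
`p(p+1)` (sequel file); the targets of prime order `ℓ ∣ p + 1` need the NON-split torus (an element of order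
`p + 1`, index `p(p-1)`) for odd `ℓ`, and for `ℓ = 2` no cyclic subgroup has odd index (Sylow `2`-subgroups of
`SL₂(𝔽_p)` are quaternion): those are not covered here. [cite: CalegariDimitrovTang2025, Corollary 4.5.3]
-/

open scoped MatrixGroups commutatorElement

namespace Literature.NumberTheory.Automorphic

namespace UnboundedDenominators

open CongruenceSubgroup Matrix.SpecialLinearGroup ModularGroup
open Literature.NumberTheory.EllipticCurves.ModularForms (specialLinearGroup_map_surjective)

variable {N : ℕ} {Q : Type*} [CommGroup Q]

/-- **`[H, H] ≤ K_θ` for `H = ⟨c⟩·Γ(N)`**: if every element of `H ≤ SL₂(ℤ)` is `cⁱ γ` with `γ ∈ Γ(N)`, then for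
every `SL₂(ℤ)`-invariant `θ : Γ(N) → Q` the commutator subgroup of `H` lies in `K_θ` (the image of `H` in
`SL₂(ℤ)/K_θ` is generated by the image of `c` and the central image of `Γ(N)`).
[cite: CalegariDimitrovTang2025, Corollary 4.5.3] -/
theorem commutator_le_ker_of_forall_eq_zpow_mul (θ : Gamma N →* Q)
    (hθ : ∀ (g x : SL(2, ℤ)) (hx : x ∈ Gamma N) (hgx : g * x * g⁻¹ ∈ Gamma N),
      θ ⟨g * x * g⁻¹, hgx⟩ = θ ⟨x, hx⟩)
    (H : Subgroup SL(2, ℤ)) (c : SL(2, ℤ))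
    (hH : ∀ y ∈ H, ∃ (i : ℤ) (γ : SL(2, ℤ)), γ ∈ Gamma N ∧ y = c ^ i * γ) :
    ⁅H, H⁆ ≤ θ.ker.map (Gamma N).subtype := by
  haveI := ker_map_subtype_normal θ hθ
  set K : Subgroup SL(2, ℤ) := θ.ker.map (Gamma N).subtype with hKdef
  set π : SL(2, ℤ) →* SL(2, ℤ) ⧸ K := QuotientGroup.mk' K with hπ
  have hcomm : ∀ a b : SL(2, ℤ), a ∈ H → b ∈ H → π a * π b = π b * π a := by
    intro a b ha hb
    obtain ⟨i, α, hα, rfl⟩ := hH a ha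
    obtain ⟨j, β, hβ, rfl⟩ := hH b hb
    have hαc : ∀ g : SL(2, ℤ) ⧸ K, g * π α = π α * g :=
      Subgroup.mem_center_iff.mp (mk_mem_center_of_mem_Gamma θ hθ hα)
    have hβc : ∀ g : SL(2, ℤ) ⧸ K, g * π β = π β * g :=
      Subgroup.mem_center_iff.mp (mk_mem_center_of_mem_Gamma θ hθ hβ)
    rw [map_mul, map_mul, map_zpow, map_zpow]
    calc π c ^ i * π α * (π c ^ j * π β)
        = π c ^ i * (π c ^ j * π β * π α) := by rw [mul_assoc, ← hαc]
      _ = π c ^ j * (π c ^ i * π β) * π α := by group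
      _ = π c ^ j * (π β * π c ^ i) * π α := by rw [hβc]
      _ = π c ^ j * π β * (π c ^ i * π α) := by group
  rw [Subgroup.commutator_def, Subgroup.closure_le]
  rintro _ ⟨a, ha, b, hb, rfl⟩
  rw [SetLike.mem_coe, ← QuotientGroup.ker_mk' K, MonoidHom.mem_ker, commutatorElement_def, map_mul, map_mul,
    map_mul, map_inv, map_inv, ← hπ, hcomm a b ha hb, mul_inv_cancel_right, mul_inv_cancel]

/-- The preimage `H ≤ SL₂(ℤ)` of the cyclic subgroup `⟨c̄⟩ ≤ SL₂(ℤ/N)`: it contains `Γ(N)`, has index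
`[SL₂(ℤ/N) : ⟨c̄⟩]`, and equals `⟨c⟩·Γ(N)` for any lift `c` of `c̄`. [cite: ShimuraIATAF1971, Lemma 1.38] -/
theorem comap_zpowers_spec [NeZero N] (cbar : SL(2, ZMod N)) :
    Gamma N ≤ (Subgroup.zpowers cbar).comap (Matrix.SpecialLinearGroup.map (Int.castRingHom (ZMod N))) ∧
    ((Subgroup.zpowers cbar).comap (Matrix.SpecialLinearGroup.map (Int.castRingHom (ZMod N)))).index =
      (Subgroup.zpowers cbar).index ∧
    ∃ c : SL(2, ℤ), ∀ y ∈ (Subgroup.zpowers cbar).comap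
        (Matrix.SpecialLinearGroup.map (Int.castRingHom (ZMod N))),
      ∃ (i : ℤ) (γ : SL(2, ℤ)), γ ∈ Gamma N ∧ y = c ^ i * γ := by
  refine ⟨?_, Subgroup.index_comap_of_surjective _ (specialLinearGroup_map_surjective N), ?_⟩
  · intro x hx
    rw [Gamma_mem'] at hx
    rw [Subgroup.mem_comap, hx]
    exact one_mem _
  · obtain ⟨c, hc⟩ := specialLinearGroup_map_surjective N cbar
    refine ⟨c, fun y hy ↦ ?_⟩
    rw [Subgroup.mem_comap, Subgroup.mem_zpowers_iff] at hy
    obtain ⟨i, hi⟩ := hy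
    refine ⟨i, c ^ (-i) * y, ?_, by rw [← mul_assoc, ← zpow_add, add_neg_cancel, zpow_zero, one_mul]⟩
    rw [Gamma_mem', map_mul, map_zpow, hc, ← hi, ← zpow_add, neg_add_cancel, zpow_zero]

/-- **The cyclic-subgroup case of the invariant form of CDT Cor. 4.5.3.**  If `SL₂(ℤ/N)` (`N ≥ 1`) contains an
element `c̄` such that `|Q|` is prime to `[SL₂(ℤ/N) : ⟨c̄⟩]`, then every `SL₂(ℤ)`-invariant `θ : Γ(N) → Q` (`Q`
finite commutative) kills `Γ(12N)`. [cite: CalegariDimitrovTang2025, Corollary 4.5.3] -/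
theorem map_eq_one_of_mem_Gamma_mul_of_zpowers [NeZero N] [Finite Q] (θ : Gamma N →* Q)
    (hθ : ∀ (g x : SL(2, ℤ)) (hx : x ∈ Gamma N) (hgx : g * x * g⁻¹ ∈ Gamma N),
      θ ⟨g * x * g⁻¹, hgx⟩ = θ ⟨x, hx⟩)
    (cbar : SL(2, ZMod N)) (hcop : (Nat.card Q).Coprime (Subgroup.zpowers cbar).index) :
    ∀ (x : SL(2, ℤ)) (hx : x ∈ Gamma N), x ∈ Gamma (12 * N) → θ ⟨x, hx⟩ = 1 := by
  haveI := ker_map_subtype_normal θ hθ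
  obtain ⟨hΓ, hidx, c, hc⟩ := comap_zpowers_spec cbar
  set H := (Subgroup.zpowers cbar).comap (Matrix.SpecialLinearGroup.map (Int.castRingHom (ZMod N)))
  haveI : H.FiniteIndex := ⟨by rw [hidx]; exact Subgroup.FiniteIndex.index_ne_zero⟩
  refine map_eq_one_of_mem_Gamma_mul_of_local θ hθ H hΓ (by rwa [hidx]) ?_
  intro y hy hyc
  rw [sup_eq_right.mpr (commutator_le_ker_of_forall_eq_zpow_mul θ hθ H c hc)] at hyc
  obtain ⟨_, h1⟩ := (mem_ker_map_subtype_iff θ).mp hyc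
  exact h1

/-- The cyclic-subgroup case in the exact shape of the invariant form (`M = 12N`).
[cite: CalegariDimitrovTang2025, Corollary 4.5.3] -/
theorem cor453_invariant_form_of_zpowers (N : ℕ) (hN : N ≠ 0) (Q : Type*) [CommGroup Q] [Finite Q]
    (θ : Gamma N →* Q)
    (hθ : ∀ (g x : SL(2, ℤ)) (hx : x ∈ Gamma N) (hgx : g * x * g⁻¹ ∈ Gamma N),
      θ ⟨g * x * g⁻¹, hgx⟩ = θ ⟨x, hx⟩)
    (cbar : SL(2, ZMod N)) (hcop : (Nat.card Q).Coprime (Subgroup.zpowers cbar).index) :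
    ∃ M : ℕ, M ≠ 0 ∧ ∀ (x : SL(2, ℤ)) (hx : x ∈ Gamma N), x ∈ Gamma M → θ ⟨x, hx⟩ = 1 := by
  haveI : NeZero N := ⟨hN⟩
  exact ⟨12 * N, Nat.mul_ne_zero (by norm_num) hN, map_eq_one_of_mem_Gamma_mul_of_zpowers θ hθ cbar hcop⟩

end UnboundedDenominators

end Literature.NumberTheory.Automorphic
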